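import Literature.NumberTheory.EllipticCurves.NewformsLevelRaising
import Literature.NumberTheory.EllipticCurves.NewformsOldNewProofs
import HarnessLib

/-!
# Level lowering on `Γ₀(N)` at a prime dividing the level, and strong multiplicity one from the
# Main Lemma alone (trunk EllArithM; `NewformsLevelRaising.lean`, `NewformsOldNewProofs.lean` continued)

Two level-lowering statements of Atkin–Lehner theory, proved on Mathlib's `CuspForm` with the
machinery of `NewformsLevelRaising` (generation of `Γ₀(L)` by `T` and `Γ₀(L) ∩ Γ⁰(p)`, the
`q`-expansion identity `p (f ∣ diag(1,p)) = ∑ⱼ f ∣ (1 j; 0 p)` for `p`-supported `f`) and of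
`HeckeOperatorsProofs` (the coset decomposition of `T_p`), plus the bookkeeping corollary that strong
multiplicity one on `Γ₀(N)` now only depends on the Atkin–Lehner Main Lemma:

* `levelLower hp hpN f hsupp : CuspForm (Gamma0 (N / p)) k` and `iota_levelLower` (**level
  lowering of `p`-supported forms**): for `p ∣ N` prime and `f ∈ S_k(Γ₀(N))` with `a_n(f) = 0` for
  all `p ∤ n`, `g(τ) = f(τ/p) = p (f ∣[k] diag(1,p))(τ)` is a cusp form of level `Γ₀(N/p)` and
  `f = ι_p g` — the converse of the easy inclusion `ι_p S_k(Γ₀(N/p)) ⊆ {a_n = 0 ∀ p ∤ n}` of the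
  Main Lemma (Diamond–Shurman §5.7, first display). Proof: `f ∣ diag(1,p)` is `T`-invariant
  (`p`-support, `slash_tpG_slash_T_of_smul_eq`) and invariant under `Γ₀(N/p) ∩ Γ⁰(p)`
  (`(a b; c e) ↦ (a, b/p; pc, e) ∈ Γ₀(N)`, `exists_tpG_mul_mapGL_eq_of_dvd`), and these generate
  `Γ₀(N/p)` (`exists_eq_T_zpow_mul_mul_T_zpow`); `diag(1,p) diag(p,1)` acts trivially
  (`tpG_mul_tpD_smul`).
* `coe_adjDegeneracyMap0_of_sq_dvd`, `exists_coe_eq_heckeT_of_sq_dvd` (**`U_p` lowers the level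
  when `p² ∣ N`**, Knapp, *Elliptic curves*, Lemma 9.26, first assertion, p. 216: "If `p² ∣ N`,
  then `T_k(p) f` is in `S_k(Γ₀(N/p))`"): the adjoint degeneracy map
  `[Γ₀(N) diag(1,p) Γ₀(N/p)] f` of `Newforms.lean`, a cusp form of level `Γ₀(N/p)` by
  construction, has the same underlying function as `T_p f = U_p f = ∑ⱼ f ∣ (1 j; 0 p)`, because for
  `p² ∣ N` the double cosets `Γ₀(N) diag(1,p) Γ₀(N/p) = Γ₀(N) diag(1,p) Γ₀(N) = ⊔ⱼ Γ₀(N)(1 j; 0 p)`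
  coincide (`exists_tpB_mul_mapGL_eq`: `(1 j; 0 p) γ = γ' (1 j'; 0 p)`, `doubleCoset_tpG_gamma0_div_eq`,
  and `existsUnique_fin`, `heckeCorrespondence_apply_eq_sum_slash_holds` of `HeckeOperatorsProofs`).
* `coe_adjDegeneracyMap0_eq_add_slash` (Knapp Lemma 9.26, second assertion, in raw form): for
  `p ∣ N` and any `γ∞ ∈ Γ₀(N/p)` with `p ∣ (γ∞)₀₀` (these exist iff `p ∥ N`, `exists_gamma_infty`,
  and then `W = diag(1,p) γ∞ = (p b; N pd)` is an Atkin–Lehner matrix),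
  `[Γ₀(N) diag(1,p) Γ₀(N/p)] f = T_p f + f ∣[k] W` as functions, from the coset decomposition
  `Γ₀(N) diag(1,p) Γ₀(N/p) = ⊔ⱼ Γ₀(N)(1 j; 0 p) ⊔ Γ₀(N) W` (`existsUnique_option_of_dvd`, with the
  two-level membership criteria `exists_mul_tpG_eq_iff_of_dvd`, `exists_mul_tpB_eq_iff_of_dvd`,
  `exists_mul_W_eq_iff_of_dvd`). So `U_p f + f ∣[k] W_p ∈ S_k(Γ₀(N/p))` for `p ∥ N`.
* `cuspFormOfInvariant`: a cusp form whose function is invariant under any arithmetic group `Γ'`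
  is a cusp form of level `Γ'` (cusps of arithmetic groups coincide); `levelLower` is
  `cuspFormOfInvariant (divLevelRaise …)`.
* `IsNewform0.eq_of_heckeEigenvalue_eq_of_atkinLehnerMainLemma0 (hML : atkinLehnerMainLemma0 N k)
  : IsNewform0.eq_of_heckeEigenvalue_eq` (named like its cross-level sibling in
  `NewformsStrongMultiplicityOne`): with `disjoint_oldSubspace0_newSubspace0_holds`
  (`NewformsOldNewProofs`) the reduction `IsNewform0.eq_of_heckeEigenvalue_eq_of_facts` of
  `NewformsLevelRaising` leaves the Main Lemma (Atkin–Lehner 1970, Thm. 1) as the only remaining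
  input to strong multiplicity one (Atkin–Lehner 1970, Thm. 4, same level).

These are the first steps of the planned proof of `atkinLehnerMainLemma0` (the `p² ∣ N` case of
the induction over the primes of the level is `f = K_p f + ι_p(U_p f)` with `U_p f ∈ S_k(Γ₀(N/p))`;
the `p ∥ N` case works with `U_p f + f ∣ W_p ∈ S_k(Γ₀(N/p))` and the involution `W_p`).

## References

* A. W. Knapp, *Elliptic curves*, Mathematical Notes 40, Princeton 1992, Lemma 9.25, Lemma 9.26
  (p. 216), Thm. 9.27.
* F. Diamond, J. Shurman, *A first course in modular forms*, GTM 228, 2005, §5.7 (`ι_d`,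
  Thm. 5.7.1), Prop. 5.2.1.
* A. O. L. Atkin, J. Lehner, *Hecke operators on `Γ₀(m)`*, Math. Ann. 185 (1970), Thms. 1, 4.
-/

noncomputable section

open scoped MatrixGroups ModularForm

open CongruenceSubgroup UpperHalfPlane ConjAct Pointwise ModularGroup Matrix.SpecialLinearGroup

namespace Literature.NumberTheory.EllipticCurves.ModularForms
/-! ### Level lowering: a `p`-supported form of level `Γ₀(N)`, `p ∣ N`, comes from level `Γ₀(N/p)` -/

section LevelLower

variable {N : ℕ} [NeZero N] {k : ℤ} {p : ℕ} [NeZero p]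

/-- For `γ = (a b; c e) ∈ Γ₀(L)` with `p ∣ b` and `N' ∣ p L`: `diag(1,p) γ = γ'' diag(1,p)` with
`γ'' = (a, b/p; pc, e) ∈ Γ₀(N')`. [folklore] -/
lemma exists_tpG_mul_mapGL_eq_of_dvd {L N' : ℕ} (hL : N' ∣ p * L) {γ : SL(2, ℤ)} (hγ : γ ∈ Gamma0 L)
    (hb : (p : ℤ) ∣ γ 0 1) :
    ∃ γ'' ∈ Gamma0 N', tpG p * (mapGL ℝ γ : GL (Fin 2) ℝ) = mapGL ℝ γ'' * tpG p := by
  obtain ⟨b', hb'⟩ := hb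
  obtain ⟨t, ht⟩ := dvd_entry_of_mem_Gamma0 L hγ
  let A : Matrix (Fin 2) (Fin 2) ℤ := !![γ 0 0, b'; p * γ 1 0, γ 1 1]
  have hdet : A.det = 1 := by
    rw [Matrix.det_fin_two_of]
    have h1 := det_entries γ
    rw [hb'] at h1
    linear_combination h1
  refine ⟨⟨A, hdet⟩, ?_, ?_⟩
  · rw [Gamma0_mem]
    have : ((p * γ 1 0 : ℤ) : ZMod N') = 0 := by
      rw [ZMod.intCast_zmod_eq_zero_iff_dvd, ht, ← mul_assoc]
      exact (Int.natCast_dvd_natCast.mpr hL).trans ⟨t, by push_cast; ring⟩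
    simpa [A] using this
  · ext i j
    simp only [Units.val_mul, Matrix.SpecialLinearGroup.mapGL_coe_matrix, val_tpG]
    have : (γ 0 1 : ℝ) = p * b' := by exact_mod_cast hb'
    fin_cases i <;> fin_cases j <;>
      simp [Matrix.mul_apply, Fin.sum_univ_two, A, this] <;> ring

omit [NeZero N] in
/-- `f ∣[k] diag(1,p)` (`f` of level `Γ₀(N)`, `p ∣ N`) is invariant under `Γ₀(N/p) ∩ Γ⁰(p)`. [folklore] -/
lemma slash_tpG_slash_mapGL_of_dvd_of_dvd_level (hpN : p ∣ N) (f : CuspForm (Gamma0 N) k)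
    {γ : SL(2, ℤ)} (hγ : γ ∈ Gamma0 (N / p)) (hb : (p : ℤ) ∣ γ 0 1) :
    ((⇑f : ℍ → ℂ) ∣[k] tpG p) ∣[k] (mapGL ℝ γ : GL (Fin 2) ℝ) = ⇑f ∣[k] tpG p := by
  obtain ⟨γ'', hγ'', h⟩ := exists_tpG_mul_mapGL_eq_of_dvd (N' := N)
    (dvd_of_eq (Nat.mul_div_cancel' hpN).symm) hγ hb
  have hmem : (mapGL ℝ γ'' : GL (Fin 2) ℝ) ∈ ((Gamma0 N : Subgroup SL(2, ℤ)) : Subgroup (GL (Fin 2) ℝ)) :=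
    ⟨γ'', hγ'', rfl⟩
  rw [← SlashAction.slash_mul, h, SlashAction.slash_mul,
    SlashInvariantFormClass.slash_action_eq f _ hmem]

omit [NeZero N] in
/-- If moreover `f ∣[k] diag(1,p)` is `T`-invariant, it is `Γ₀(N/p)`-invariant. [folklore] -/
lemma slash_tpG_slash_mapGL_of_slash_T_of_dvd_level (hp : p.Prime) (hpN : p ∣ N)
    (f : CuspForm (Gamma0 N) k)
    (hFT : ((⇑f : ℍ → ℂ) ∣[k] tpG p) ∣[k] (mapGL ℝ T : GL (Fin 2) ℝ) = ⇑f ∣[k] tpG p)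
    {γ : SL(2, ℤ)} (hγ : γ ∈ Gamma0 (N / p)) :
    ((⇑f : ℍ → ℂ) ∣[k] tpG p) ∣[k] (mapGL ℝ γ : GL (Fin 2) ℝ) = ⇑f ∣[k] tpG p := by
  obtain ⟨i, j, γ', hγ', hdvd, rfl⟩ := exists_eq_T_zpow_mul_mul_T_zpow (N := N / p) hp hγ
  rw [map_mul, map_mul, SlashAction.slash_mul, SlashAction.slash_mul,
    slash_mapGL_zpow_of_slash_eq k hFT i, slash_tpG_slash_mapGL_of_dvd_of_dvd_level hpN f hγ' hdvd,
    slash_mapGL_zpow_of_slash_eq k hFT j]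

/-- A cusp form of level `Γ` whose underlying function is invariant under an arithmetic group `Γ'`
(no inclusion between `Γ` and `Γ'` is required) is a cusp form of level `Γ'`: the cusps of all
arithmetic groups coincide (Mathlib `Subgroup.IsArithmetic.isCusp_iff_isCusp_SL2Z`). [folklore] -/
def cuspFormOfInvariant {Γ Γ' : Subgroup (GL (Fin 2) ℝ)} [Γ.IsArithmetic] [Γ'.IsArithmetic]
    (f : CuspForm Γ k) (hinv : ∀ γ ∈ Γ', (⇑f : ℍ → ℂ) ∣[k] γ = ⇑f) : CuspForm Γ' k where
  toFun := f
  slash_action_eq' γ hγ := hinv γ hγ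
  holo' := f.holo'
  zero_at_cusps' hc := f.zero_at_cusps'
    ((Subgroup.IsArithmetic.isCusp_iff_isCusp_SL2Z _).mpr
      ((Subgroup.IsArithmetic.isCusp_iff_isCusp_SL2Z _).mp hc))

/-- `cuspFormOfInvariant` does not change the function. [folklore] -/
@[simp] lemma coe_cuspFormOfInvariant {Γ Γ' : Subgroup (GL (Fin 2) ℝ)} [Γ.IsArithmetic]
    [Γ'.IsArithmetic] (f : CuspForm Γ k) (hinv : ∀ γ ∈ Γ', (⇑f : ℍ → ℂ) ∣[k] γ = ⇑f) :
    (⇑(cuspFormOfInvariant f hinv) : ℍ → ℂ) = ⇑f := rfl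

/-- **Level lowering**: for `p ∣ N` prime and `f ∈ S_k(Γ₀(N))` with `a_n(f) = 0` for all `p ∤ n`,
`g(τ) = f(τ/p) = p (f ∣[k] diag(1,p))(τ)` is a cusp form of level `Γ₀(N/p)` (and `f = ι_p g`,
`iota_levelLower`) (Atkin–Lehner 1970; Diamond–Shurman §5.7; the converse direction of the Main
Lemma's easy inclusion). [folklore] -/
def levelLower (hp : p.Prime) (hpN : p ∣ N) (f : CuspForm (Gamma0 N) k)
    (hsupp : ∀ n : ℕ, ¬ p ∣ n → (qExpansion 1 ⇑f).coeff n = 0) : CuspForm (Gamma0 (N / p)) k :=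
  haveI : NeZero (N / p) := ⟨(Nat.div_pos (Nat.le_of_dvd (NeZero.pos N) hpN) hp.pos).ne'⟩
  cuspFormOfInvariant (divLevelRaise hp f hsupp) fun A hA ↦ by
    obtain ⟨γ, hγ, rfl⟩ := hA
    have hinv := slash_tpG_slash_mapGL_of_slash_T_of_dvd_level hp hpN f
      (slash_tpG_slash_T_of_smul_eq k f (smul_slash_tpG_eq_sum_slash_tpB k hp f hsupp)) hγ
    have hσ : σ (mapGL ℝ γ : GL (Fin 2) ℝ) (p : ℂ) = p :=
      σ_eq_self (by simp [Matrix.SpecialLinearGroup.det_mapGL]) _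
    rw [coe_divLevelRaise, ModularForm.smul_slash, hσ, hinv]

/-- `levelLower f = p · (f ∣[k] diag(1,p))` as a function, i.e. `τ ↦ f(τ/p)` (the same function as
`divLevelRaise f` of `NewformsLevelRaising`, now at level `Γ₀(N/p)`). [folklore] -/
lemma coe_levelLower (hp : p.Prime) (hpN : p ∣ N) (f : CuspForm (Gamma0 N) k)
    (hsupp : ∀ n : ℕ, ¬ p ∣ n → (qExpansion 1 ⇑f).coeff n = 0) :
    (⇑(levelLower hp hpN f hsupp) : ℍ → ℂ) = (p : ℂ) • ((⇑f : ℍ → ℂ) ∣[k] tpG p) := rfl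

/-- `diag(1,p) diag(p,1) = p · 1` acts trivially on `ℍ`. [folklore] -/
lemma tpG_mul_tpD_smul (τ : ℍ) : (tpG p * tpD p) • τ = τ := by
  have hval : ((tpG p * tpD p : GL (Fin 2) ℝ) : Matrix (Fin 2) (Fin 2) ℝ) = !![(p : ℝ), 0; 0, (p : ℝ)] := by
    rw [Matrix.GeneralLinearGroup.coe_mul, val_tpG, val_tpD]
    ext i j
    fin_cases i <;> fin_cases j <;> simp [Matrix.mul_apply, Fin.sum_univ_two]
  have hdet : 0 < (tpG p * tpD p).det.val := by
    rw [Matrix.GeneralLinearGroup.val_det_apply, hval, Matrix.det_fin_two_of]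
    have : (0 : ℝ) < p := by exact_mod_cast NeZero.pos p
    nlinarith
  apply UpperHalfPlane.ext
  rw [coe_smul_of_det_pos hdet]
  have hp0 : (p : ℂ) ≠ 0 := by exact_mod_cast NeZero.ne p
  simp [num, denom, hval, hp0]

/-- **`f = ι_p(levelLower f)`**: `(ι_p g)(τ) = g(pτ) = f(pτ/p) = f(τ)`. [folklore] -/
lemma iota_levelLower (hp : p.Prime) (hpN : p ∣ N) (f : CuspForm (Gamma0 N) k)
    (hsupp : ∀ n : ℕ, ¬ p ∣ n → (qExpansion 1 ⇑f).coeff n = 0) :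
    iota (N / p) N p k (dvd_of_eq (Nat.div_mul_cancel hpN)) (levelLower hp hpN f hsupp) = f := by
  ext τ
  rw [iota_apply]
  change (p : ℂ) * ((⇑f : ℍ → ℂ) ∣[k] tpG p) (tpD p • τ) = f τ
  rw [← tpB_zero, slash_tpB_apply, tpB_zero, ← mul_smul, tpG_mul_tpD_smul, ← mul_assoc,
    mul_inv_cancel₀ (by exact_mod_cast NeZero.ne p : (p : ℂ) ≠ 0), one_mul]

end LevelLower

/-! ### `U_p` lowers the level when `p² ∣ N` (Knapp, *Elliptic curves*, Lemma 9.26, first part) -/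

section UpLower

variable {N : ℕ} [NeZero N] {k : ℤ} {p : ℕ} [NeZero p]

omit [NeZero N] in
/-- For `p² ∣ N`, `γ = (a b; c d) ∈ Γ₀(N/p)` and `j`: `(1 j; 0 p) γ = γ' (1 j'; 0 p)` with
`γ' ∈ Γ₀(N)`, where `j' a ≡ b + j d (mod p)` — here `p ∣ c`, so `p ∤ a`. [folklore] -/
lemma exists_tpB_mul_mapGL_eq (hp : p.Prime) (hp2 : p * p ∣ N) {γ : SL(2, ℤ)} (hγ : γ ∈ Gamma0 (N / p))
    (j : ℤ) : ∃ (j' : ℤ) (γ' : SL(2, ℤ)), γ' ∈ Gamma0 N ∧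
      tpB p j * (mapGL ℝ γ : GL (Fin 2) ℝ) = mapGL ℝ γ' * tpB p j' := by
  have hpN : p ∣ N := (dvd_mul_right p p).trans hp2
  have hpM : (p : ℤ) ∣ (N / p : ℕ) := by
    have : p ∣ N / p := Nat.dvd_div_of_mul_dvd hp2
    exact_mod_cast this
  obtain ⟨t, ht⟩ := dvd_entry_of_mem_Gamma0 (N / p) hγ
  have hc : (p : ℤ) ∣ γ 1 0 := ht ▸ hpM.mul_right t
  -- `p ∤ a + j c` (indeed `≡ a`, and `p ∣ a, p ∣ c` contradicts the determinant)
  have ha : ¬ (p : ℤ) ∣ γ 0 0 + j * γ 1 0 := by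
    intro h
    have ha' : (p : ℤ) ∣ γ 0 0 := by simpa using (dvd_sub h (hc.mul_left j))
    have h1 : (p : ℤ) ∣ γ 0 0 * γ 1 1 - γ 0 1 * γ 1 0 :=
      dvd_sub (dvd_mul_of_dvd_left ha' _) (dvd_mul_of_dvd_right hc _)
    rw [det_entries γ] at h1
    exact hp.one_lt.ne' (Nat.dvd_one.mp (Int.natCast_dvd_natCast.mp h1))
  -- solve `j' (a + j c) ≡ b + j d (mod p)`
  have hcop : IsCoprime (γ 0 0 + j * γ 1 0) (p : ℤ) := by
    rw [Int.isCoprime_iff_gcd_eq_one, Int.gcd, Int.natAbs_natCast]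
    exact Nat.coprime_comm.mp ((Nat.Prime.coprime_iff_not_dvd hp).mpr
      fun h ↦ ha (Int.natCast_dvd.mpr h))
  obtain ⟨x, y, hxy⟩ := hcop
  set j' : ℤ := x * (γ 0 1 + j * γ 1 1) with hj'
  -- `b + j d - j'(a + j c) = p * e`
  have he : (p : ℤ) ∣ γ 0 1 + j * γ 1 1 - j' * (γ 0 0 + j * γ 1 0) :=
    ⟨y * (γ 0 1 + j * γ 1 1), by rw [hj']; linear_combination -(γ 0 1 + j * γ 1 1) * hxy⟩
  obtain ⟨e, he⟩ := he
  obtain ⟨c', hc'⟩ := hc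
  let A : Matrix (Fin 2) (Fin 2) ℤ := !![γ 0 0 + j * γ 1 0, e; p * γ 1 0, γ 1 1 - j' * γ 1 0]
  have hdet : A.det = 1 := by
    rw [Matrix.det_fin_two_of]
    have h1 := det_entries γ
    have he' : e * p = γ 0 1 + j * γ 1 1 - j' * (γ 0 0 + j * γ 1 0) := by rw [he]; ring
    linear_combination h1 - (γ 1 0) * he'
  refine ⟨j', ⟨A, hdet⟩, ?_, ?_⟩
  · rw [Gamma0_mem]
    have : ((p * γ 1 0 : ℤ) : ZMod N) = 0 := by
      rw [ZMod.intCast_zmod_eq_zero_iff_dvd, ht, ← mul_assoc]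
      refine (Int.natCast_dvd_natCast.mpr (dvd_of_eq (Nat.mul_div_cancel' hpN).symm)).trans ?_
      exact ⟨t, by push_cast; ring⟩
    simpa [A] using this
  · ext i r
    simp only [Units.val_mul, Matrix.SpecialLinearGroup.mapGL_coe_matrix, val_tpB]
    have he' : (e : ℝ) * p = γ 0 1 + j * γ 1 1 - j' * (γ 0 0 + j * γ 1 0) := by
      exact_mod_cast (show e * (p : ℤ) = _ by rw [he]; ring)
    fin_cases i <;> fin_cases r <;>
      simp [Matrix.mul_apply, Fin.sum_univ_two, A] <;> nlinarith [he']

end UpLower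

section UpLower2

variable {N : ℕ} [NeZero N] {k : ℤ} {p : ℕ} [NeZero p]

omit [NeZero N] in
/-- For `p² ∣ N` the double cosets `Γ₀(N) diag(1,p) Γ₀(N/p)` and `Γ₀(N) diag(1,p) Γ₀(N)` coincide
(`diag(1,p) δ = γ' (1 j'; 0 p)` for `δ ∈ Γ₀(N/p)`, `exists_tpB_mul_mapGL_eq`). [folklore] -/
lemma doubleCoset_tpG_gamma0_div_eq (hp : p.Prime) (hp2 : p * p ∣ N) :
    DoubleCoset.doubleCoset (tpG p)
      (((Gamma0 N : Subgroup SL(2, ℤ)) : Subgroup (GL (Fin 2) ℝ)) : Set (GL (Fin 2) ℝ))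
      (((Gamma0 (N / p) : Subgroup SL(2, ℤ)) : Subgroup (GL (Fin 2) ℝ)) : Set (GL (Fin 2) ℝ)) =
    DoubleCoset.doubleCoset (tpG p)
      (((Gamma0 N : Subgroup SL(2, ℤ)) : Subgroup (GL (Fin 2) ℝ)) : Set (GL (Fin 2) ℝ))
      (((Gamma0 N : Subgroup SL(2, ℤ)) : Subgroup (GL (Fin 2) ℝ)) : Set (GL (Fin 2) ℝ)) := by
  have hpN : p ∣ N := (dvd_mul_right p p).trans hp2
  apply Set.Subset.antisymm
  · intro x hx
    obtain ⟨x₁, hx₁, x₂, hx₂, rfl⟩ := DoubleCoset.mem_doubleCoset.mp hx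
    obtain ⟨δ, hδ, rfl⟩ := Subgroup.mem_map.mp hx₂
    obtain ⟨j', γ', hγ', hmul⟩ := exists_tpB_mul_mapGL_eq (N := N) hp hp2 hδ 0
    rw [tpB_zero] at hmul
    refine DoubleCoset.mem_doubleCoset.mpr ⟨x₁ * mapGL ℝ γ', mul_mem hx₁ ⟨γ', hγ', rfl⟩,
      mapGL ℝ (T ^ j'), ⟨T ^ j', T_zpow_mem_Gamma0 N j', rfl⟩, ?_⟩
    rw [mul_assoc x₁ (tpG p), hmul, tpB]
    simp only [mul_assoc]
  · intro x hx
    obtain ⟨x₁, hx₁, x₂, hx₂, rfl⟩ := DoubleCoset.mem_doubleCoset.mp hx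
    exact DoubleCoset.mem_doubleCoset.mpr ⟨x₁, hx₁, x₂, Gamma0GL_le_of_dvd (Nat.div_dvd_of_dvd hpN) hx₂, rfl⟩

/-- **`U_p` lowers the level when `p² ∣ N`** (Knapp, *Elliptic curves*, Lemma 9.26, first assertion:
"If `p² ∣ N`, then `T_k(p) f` is in `S_k(Γ₀(N/p))`"; Atkin–Lehner 1970): the adjoint degeneracy map
`[Γ₀(N) diag(1,p) Γ₀(N/p)] f`, a cusp form of level `Γ₀(N/p)` by construction, has the same
underlying function as `T_p f = U_p f = ∑ⱼ f ∣ (1 j; 0 p)`, since the double coset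
`Γ₀(N) diag(1,p) Γ₀(N/p) = ⊔ⱼ Γ₀(N)(1 j; 0 p)` (`doubleCoset_tpG_gamma0_div_eq`, `existsUnique_fin`;
double coset formula `heckeCorrespondence_apply_eq_sum_slash_holds`). [folklore] -/
theorem coe_adjDegeneracyMap0_of_sq_dvd (hp : p.Prime) (hp2 : p * p ∣ N)
    [NeZero (N / p)] (f : CuspForm (Gamma0 N) k) :
    (⇑(adjDegeneracyMap0 N (N / p) p k f) : ℍ → ℂ) = ⇑(heckeT (Gamma0 N) k p f) := by
  haveI : Fact p.Prime := ⟨hp⟩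
  have hpN : p ∣ N := (dvd_mul_right p p).trans hp2
  rw [coe_heckeT_gamma0_eq_sum N k p hp f, if_pos hpN, add_zero]
  change ⇑(heckeCorrespondence (Gamma0 N) (Gamma0 (N / p)) k
    (diagGL 1 p one_pos (Nat.cast_pos.mpr (NeZero.pos p))) (f : ModularForm (Gamma0 N) k)) = _
  refine heckeCorrespondence_apply_eq_sum_slash_holds _ _ k _ (fun j : Fin p ↦ tpB p ((j : ℕ) : ℤ))
    (fun j ↦ ?_) (fun x hx ↦ ?_) _
  · change tpB p ((j : ℕ) : ℤ) ∈ DoubleCoset.doubleCoset (tpG p) _ _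
    rw [doubleCoset_tpG_gamma0_div_eq hp hp2]
    exact tpB_mem_doubleCoset p N _
  · change x ∈ DoubleCoset.doubleCoset (tpG p) _ _ at hx
    rw [doubleCoset_tpG_gamma0_div_eq hp hp2] at hx
    exact existsUnique_fin p N hpN x hx

/-- `U_p f` as a cusp form of level `Γ₀(N/p)` for `p² ∣ N`: the adjoint degeneracy map. [folklore] -/
theorem exists_coe_eq_heckeT_of_sq_dvd (hp : p.Prime) (hp2 : p * p ∣ N) [NeZero (N / p)]
    (f : CuspForm (Gamma0 N) k) :
    ∃ g : CuspForm (Gamma0 (N / p)) k, (⇑g : ℍ → ℂ) = ⇑(heckeT (Gamma0 N) k p f) :=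
  ⟨adjDegeneracyMap0 N (N / p) p k f, coe_adjDegeneracyMap0_of_sq_dvd hp hp2 f⟩

end UpLower2


/-! ### `p ∥ N`: the adjoint degeneracy map is `U_p f + f ∣ W_p` (Knapp Lemma 9.26, second part) -/

section NotSqDvd

variable {N : ℕ} [NeZero N] {k : ℤ} {p : ℕ} [NeZero p]

omit [NeZero N] in
/-- For `γ = (a b; c d) ∈ Γ₀(N/p)` with `p ∤ a`: `diag(1,p) γ = γ' (1 j'; 0 p)` with `γ' ∈ Γ₀(N)`
(`j' a ≡ b (mod p)`). [folklore] -/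
lemma exists_tpG_mul_mapGL_eq_mul_tpB (hp : p.Prime) (hpN : p ∣ N) {γ : SL(2, ℤ)}
    (hγ : γ ∈ Gamma0 (N / p)) (ha : ¬ (p : ℤ) ∣ γ 0 0) :
    ∃ (j' : ℤ) (γ' : SL(2, ℤ)), γ' ∈ Gamma0 N ∧
      tpG p * (mapGL ℝ γ : GL (Fin 2) ℝ) = mapGL ℝ γ' * tpB p j' := by
  obtain ⟨t, ht⟩ := dvd_entry_of_mem_Gamma0 (N / p) hγ
  have hcop : IsCoprime (γ 0 0) (p : ℤ) := by
    rw [Int.isCoprime_iff_gcd_eq_one, Int.gcd, Int.natAbs_natCast]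
    exact Nat.coprime_comm.mp ((Nat.Prime.coprime_iff_not_dvd hp).mpr
      fun h ↦ ha (Int.natCast_dvd.mpr h))
  obtain ⟨x, y, hxy⟩ := hcop
  set j' : ℤ := x * γ 0 1 with hj'
  have he : (p : ℤ) ∣ γ 0 1 - j' * γ 0 0 :=
    ⟨y * γ 0 1, by rw [hj']; linear_combination -(γ 0 1) * hxy⟩
  obtain ⟨e, he⟩ := he
  let A : Matrix (Fin 2) (Fin 2) ℤ := !![γ 0 0, e; p * γ 1 0, γ 1 1 - j' * γ 1 0]
  have hdet : A.det = 1 := by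
    rw [Matrix.det_fin_two_of]
    have h1 := det_entries γ
    have he' : e * p = γ 0 1 - j' * γ 0 0 := by rw [he]; ring
    linear_combination h1 - (γ 1 0) * he'
  refine ⟨j', ⟨A, hdet⟩, ?_, ?_⟩
  · rw [Gamma0_mem]
    have : ((p * γ 1 0 : ℤ) : ZMod N) = 0 := by
      rw [ZMod.intCast_zmod_eq_zero_iff_dvd, ht, ← mul_assoc]
      refine (Int.natCast_dvd_natCast.mpr (dvd_of_eq (Nat.mul_div_cancel' hpN).symm)).trans ?_
      exact ⟨t, by push_cast; ring⟩
    simpa [A] using this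
  · ext i r
    simp only [Units.val_mul, Matrix.SpecialLinearGroup.mapGL_coe_matrix, val_tpB, val_tpG]
    have he' : (e : ℝ) * p = γ 0 1 - j' * γ 0 0 := by
      exact_mod_cast (show e * (p : ℤ) = _ by rw [he]; ring)
    fin_cases i <;> fin_cases r <;>
      simp [Matrix.mul_apply, Fin.sum_univ_two, A] <;> nlinarith [he']

omit [NeZero N] in
/-- `diag(1,p) Tʲ diag(1,p)⁻¹ = (1, j/p; 0, 1)` lies in `Γ₀(N)` only if `p ∣ j`. [folklore] -/
lemma dvd_of_tpB_mul_tpB_inv_mem {j j' : ℤ}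
    (h : tpB p j * (tpB p j')⁻¹ ∈ ((Gamma0 N : Subgroup SL(2, ℤ)) : Subgroup (GL (Fin 2) ℝ))) :
    (p : ℤ) ∣ j - j' := by
  obtain ⟨γ, -, hγ⟩ := h
  have h01 := congrArg (fun A : GL (Fin 2) ℝ ↦ ((A * tpB p j' : GL (Fin 2) ℝ) : Matrix (Fin 2) (Fin 2) ℝ) 0 1) hγ
  simp only [inv_mul_cancel_right] at h01
  simp only [Units.val_mul, Matrix.SpecialLinearGroup.mapGL_coe_matrix, val_tpB, Matrix.mul_apply,
    Fin.sum_univ_two] at h01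
  simp at h01
  -- `γ₀₀ * j' + γ₀₁ * p = j`, and `γ₀₀ = 1` from the (0,0) entry
  have h00 := congrArg (fun A : GL (Fin 2) ℝ ↦ ((A * tpB p j' : GL (Fin 2) ℝ) : Matrix (Fin 2) (Fin 2) ℝ) 0 0) hγ
  simp only [inv_mul_cancel_right] at h00
  simp only [Units.val_mul, Matrix.SpecialLinearGroup.mapGL_coe_matrix, val_tpB, Matrix.mul_apply,
    Fin.sum_univ_two] at h00
  simp at h00
  have h00' : (γ 0 0 : ℝ) = 1 := by exact_mod_cast h00
  rw [h00', one_mul] at h01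
  refine ⟨γ 0 1, ?_⟩
  have : (j : ℝ) - j' = p * (γ 0 1 : ℤ) := by linarith
  exact_mod_cast this

end NotSqDvd

section NotSqDvd2

variable (N : ℕ) (p : ℕ) [NeZero p]

/-- Two-level version of `exists_mul_tpG_eq_iff`: for `M ∈ Γ₀(N/p)` (`p ∣ N`),
`γ diag(1,p) = diag(1,p) M` is solvable with `γ ∈ Γ₀(N)` iff `p ∣ M₀₁`. [folklore] -/
lemma exists_mul_tpG_eq_iff_of_dvd (hpN : p ∣ N) {M : SL(2, ℤ)} (hM : M ∈ Gamma0 (N / p)) :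
    (∃ γ ∈ ((Gamma0 N : Subgroup SL(2, ℤ)) : Subgroup (GL (Fin 2) ℝ)),
      γ * tpG p = tpG p * Matrix.SpecialLinearGroup.mapGL ℝ M) ↔ (p : ℤ) ∣ M 0 1 := by
  constructor
  · rintro ⟨γ, hγ, h⟩
    obtain ⟨g, -, rfl⟩ := Subgroup.mem_map.mp hγ
    have h01 := congrArg (fun A : GL (Fin 2) ℝ ↦ (A : Matrix (Fin 2) (Fin 2) ℝ) 0 1) h
    simp only [Matrix.GeneralLinearGroup.coe_mul, val_tpG, val_mapGL', Matrix.mul_apply,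
      Fin.sum_univ_two] at h01
    simp at h01
    refine ⟨g 0 1, ?_⟩
    exact_mod_cast (by rw [← h01]; ring : (M 0 1 : ℝ) = p * g 0 1)
  · intro hb
    obtain ⟨γ'', hγ'', h⟩ := exists_tpG_mul_mapGL_eq_of_dvd (p := p) (L := N / p) (N' := N)
      (dvd_of_eq (Nat.mul_div_cancel' hpN).symm) hM hb
    exact ⟨_, ⟨γ'', hγ'', rfl⟩, h.symm⟩

/-- Two-level version of `exists_mul_tpB_eq_iff`: `γ (1 j; 0 p) = diag(1,p) M` is solvable in
`Γ₀(N)` iff `p ∣ M₀₁ - j M₀₀`, for `M ∈ Γ₀(N/p)`. [folklore] -/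
lemma exists_mul_tpB_eq_iff_of_dvd (hpN : p ∣ N) {M : SL(2, ℤ)} (hM : M ∈ Gamma0 (N / p)) (j : ℤ) :
    (∃ γ ∈ ((Gamma0 N : Subgroup SL(2, ℤ)) : Subgroup (GL (Fin 2) ℝ)),
      γ * tpB p j = tpG p * Matrix.SpecialLinearGroup.mapGL ℝ M) ↔
      (p : ℤ) ∣ M 0 1 - j * M 0 0 := by
  have hMT : M * T ^ (-j) ∈ Gamma0 (N / p) := mul_mem hM (T_zpow_mem_Gamma0 (N / p) (-j))
  have key := exists_mul_tpG_eq_iff_of_dvd N p hpN hMT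
  have h01 : (M * T ^ (-j)) 0 1 = M 0 1 - j * M 0 0 := by
    change ((M : Matrix (Fin 2) (Fin 2) ℤ) * (T ^ (-j) : SL(2, ℤ))) 0 1 = _
    rw [coe_T_zpow]
    simp [Matrix.mul_apply, Fin.sum_univ_two]
    ring
  rw [h01] at key
  rw [← key]
  refine exists_congr fun γ ↦ and_congr_right fun _ ↦ ?_
  rw [tpB, map_mul, map_zpow _ T (-j), _root_.zpow_neg, ← map_zpow, ← mul_assoc (tpG p),
    eq_mul_inv_iff_mul_eq, mul_assoc]

/-- For the extra representative `W = diag(1,p) γi`, `γi ∈ Γ₀(N/p)` with `p ∣ (γi)₀₀`: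
`γ W = diag(1,p) M` is solvable in `Γ₀(N)` iff `p ∣ M₀₀`. [folklore] -/
lemma exists_mul_W_eq_iff_of_dvd (hp : p.Prime) (hpN : p ∣ N) {M : SL(2, ℤ)}
    (hM : M ∈ Gamma0 (N / p)) {γi : SL(2, ℤ)} (hγi : γi ∈ Gamma0 (N / p))
    (hγia : (p : ℤ) ∣ γi 0 0) :
    (∃ γ ∈ ((Gamma0 N : Subgroup SL(2, ℤ)) : Subgroup (GL (Fin 2) ℝ)),
      γ * (tpG p * Matrix.SpecialLinearGroup.mapGL ℝ γi) =
        tpG p * Matrix.SpecialLinearGroup.mapGL ℝ M) ↔ (p : ℤ) ∣ M 0 0 := by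
  have hMγ : M * γi⁻¹ ∈ Gamma0 (N / p) := mul_mem hM (inv_mem hγi)
  have key := exists_mul_tpG_eq_iff_of_dvd N p hpN hMγ
  have h01 : (M * γi⁻¹) 0 1 = -(M 0 0 * γi 0 1) + M 0 1 * γi 0 0 := by
    change ((M : Matrix (Fin 2) (Fin 2) ℤ) * ((γi⁻¹ : SL(2, ℤ)) : Matrix (Fin 2) (Fin 2) ℤ)) 0 1 = _
    rw [Matrix.SpecialLinearGroup.coe_inv, Matrix.adjugate_fin_two]
    simp [Matrix.mul_apply, Fin.sum_univ_two]
  rw [h01] at key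
  have hb : ¬ (p : ℤ) ∣ γi 0 1 := by
    intro hb
    have h1 : (p : ℤ) ∣ γi 0 0 * γi 1 1 - γi 0 1 * γi 1 0 :=
      dvd_sub (dvd_mul_of_dvd_left hγia _) (dvd_mul_of_dvd_left hb _)
    rw [det_entries γi] at h1
    exact hp.one_lt.ne' (Nat.dvd_one.mp (Int.natCast_dvd_natCast.mp h1))
  have hiff : (p : ℤ) ∣ -(M 0 0 * γi 0 1) + M 0 1 * γi 0 0 ↔ (p : ℤ) ∣ M 0 0 := by
    rw [dvd_add_left (dvd_mul_of_dvd_right hγia _), dvd_neg]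
    constructor
    · intro h
      rcases (Int.prime_iff_natAbs_prime.mpr (by simpa using hp)).dvd_or_dvd h with h1 | h1
      · exact h1
      · exact absurd h1 hb
    · exact fun h ↦ dvd_mul_of_dvd_left h _
  rw [hiff] at key
  rw [← key]
  refine exists_congr fun γ ↦ and_congr_right fun _ ↦ ?_
  rw [map_mul, map_inv, ← mul_assoc (tpG p), eq_mul_inv_iff_mul_eq, mul_assoc γ]

/-- Coset decomposition `Γ₀(N) diag(1,p) Γ₀(N/p) = ⊔ⱼ Γ₀(N)(1 j; 0 p) ⊔ Γ₀(N) diag(1,p) γi`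
(`p ∣ N`; for `p² ∣ N` the last orbit is empty, cf. `doubleCoset_tpG_gamma0_div_eq`; for
`p ∥ N` it is the Atkin–Lehner coset). [folklore] -/
lemma existsUnique_option_of_dvd [Fact p.Prime] (hpN : p ∣ N) {γi : SL(2, ℤ)}
    (hγi : γi ∈ Gamma0 (N / p)) (hγia : (p : ℤ) ∣ γi 0 0) (x : GL (Fin 2) ℝ)
    (hx : x ∈ DoubleCoset.doubleCoset (tpG p)
      (((Gamma0 N : Subgroup SL(2, ℤ)) : Subgroup (GL (Fin 2) ℝ)) : Set (GL (Fin 2) ℝ))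
      (((Gamma0 (N / p) : Subgroup SL(2, ℤ)) : Subgroup (GL (Fin 2) ℝ)) : Set (GL (Fin 2) ℝ))) :
    ∃! i : Option (Fin p),
      x * (i.elim (tpG p * Matrix.SpecialLinearGroup.mapGL ℝ γi) fun j ↦ tpB p ((j : ℕ) : ℤ))⁻¹ ∈
      ((Gamma0 N : Subgroup SL(2, ℤ)) : Subgroup (GL (Fin 2) ℝ)) := by
  have hp : p.Prime := Fact.out
  obtain ⟨x₁, hx₁, x₂, hx₂, rfl⟩ := DoubleCoset.mem_doubleCoset.mp hx
  obtain ⟨M, hM, rfl⟩ := Subgroup.mem_map.mp hx₂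
  have hdet := det_entries M
  by_cases ha : (p : ℤ) ∣ M 0 0
  · refine ⟨none, ?_, ?_⟩
    · simp only [Option.elim]
      rw [mul_inv_mem_iff_exists hx₁, exists_mul_W_eq_iff_of_dvd N p hp hpN hM hγi hγia]
      exact ha
    · rintro (_ | j) hj
      · rfl
      exfalso
      simp only [Option.elim] at hj
      rw [mul_inv_mem_iff_exists hx₁, exists_mul_tpB_eq_iff_of_dvd N p hpN hM] at hj
      exact not_dvd_sub_mul_of_dvd hdet ha _ hj
  · obtain ⟨j, hj, hju⟩ := existsUnique_fin_dvd_sub_mul (M 0 1) ha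
    refine ⟨some j, ?_, ?_⟩
    · simp only [Option.elim]
      rw [mul_inv_mem_iff_exists hx₁, exists_mul_tpB_eq_iff_of_dvd N p hpN hM]
      exact_mod_cast hj
    · rintro (_ | j') hj'
      · exfalso
        simp only [Option.elim] at hj'
        rw [mul_inv_mem_iff_exists hx₁, exists_mul_W_eq_iff_of_dvd N p hp hpN hM hγi hγia] at hj'
        exact ha hj'
      · simp only [Option.elim] at hj'
        rw [mul_inv_mem_iff_exists hx₁, exists_mul_tpB_eq_iff_of_dvd N p hpN hM] at hj'
        rw [hju j' (by exact_mod_cast hj')]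

variable {N p} [NeZero N] {k : ℤ}

/-- **The adjoint degeneracy map at `p ∣ N` is `U_p f + f ∣ W`** (Knapp, *Elliptic curves*,
Lemma 9.26, second assertion, p. 216: "If `p ∣ N` and `p² ∤ N`, then
`T_k(p) f + p^{k/2-1} w_p f` is in `S_k(Γ₀(N/p))`"; here in the form:
`[Γ₀(N) diag(1,p) Γ₀(N/p)] f = T_p f + f ∣[k] W` as functions, with `W = diag(1,p) γi` for any
`γi ∈ Γ₀(N/p)` with `p ∣ (γi)₀₀` — such `γi` exist exactly when `p ∥ N`, and then
`W = (p b; N pd)` is an Atkin–Lehner matrix; Mathlib's slash carries `det^{k-1}`, which is the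
source's `p^{k/2-1} w_p` up to the normalisation of `w_p`). The left side is a cusp form of level
`Γ₀(N/p)` by construction. Proof: the double coset formula with the decomposition
`existsUnique_option_of_dvd`. [cite: Knapp1993, Lemma 9.26 (second assertion), p. 216] -/
theorem coe_adjDegeneracyMap0_eq_add_slash (hp : p.Prime) (hpN : p ∣ N) [NeZero (N / p)]
    {γi : SL(2, ℤ)} (hγi : γi ∈ Gamma0 (N / p)) (hγia : (p : ℤ) ∣ γi 0 0)
    (f : CuspForm (Gamma0 N) k) :
    (⇑(adjDegeneracyMap0 N (N / p) p k f) : ℍ → ℂ) =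
      ⇑(heckeT (Gamma0 N) k p f) + ⇑f ∣[k] (tpG p * Matrix.SpecialLinearGroup.mapGL ℝ γi) := by
  haveI : Fact p.Prime := ⟨hp⟩
  rw [coe_heckeT_gamma0_eq_sum N k p hp f, if_pos hpN, add_zero]
  change ⇑(heckeCorrespondence (Gamma0 N) (Gamma0 (N / p)) k
    (diagGL 1 p one_pos (Nat.cast_pos.mpr (NeZero.pos p))) (f : ModularForm (Gamma0 N) k)) = _
  rw [heckeCorrespondence_apply_eq_sum_slash_holds _ _ k _
      (fun i : Option (Fin p) ↦ i.elim (tpG p * Matrix.SpecialLinearGroup.mapGL ℝ γi)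
        fun j ↦ tpB p ((j : ℕ) : ℤ))
      (by
        rintro (_ | j)
        · exact DoubleCoset.mem_doubleCoset.mpr ⟨1, one_mem _, _, ⟨γi, hγi, rfl⟩, by simp; rfl⟩
        · exact DoubleCoset.mem_doubleCoset.mpr
            ⟨1, one_mem _, _, ⟨T ^ ((j : ℕ) : ℤ), T_zpow_mem_Gamma0 (N / p) _, rfl⟩, by simp [tpB]; rfl⟩)
      (existsUnique_option_of_dvd N p hpN hγi hγia) _,
    Fintype.sum_option, add_comm]
  rfl

omit [NeZero p] [NeZero N] in
/-- For `p ∥ N` there is `γi = (p b; N/p d) ∈ Γ₀(N/p)` with `p ∣ (γi)₀₀` (Bezout for the coprime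
`p`, `N/p`); then `diag(1,p) γi = (p b; N pd)` is an Atkin–Lehner matrix `W_p`. [folklore] -/
lemma exists_gamma_infty (hp : p.Prime) (hpN : p ∣ N) (hp2 : ¬ p * p ∣ N) :
    ∃ γi : SL(2, ℤ), γi ∈ Gamma0 (N / p) ∧ (p : ℤ) ∣ γi 0 0 := by
  have hcop : Nat.Coprime p (N / p) := by
    rw [Nat.Prime.coprime_iff_not_dvd hp]
    intro h
    exact hp2 (by simpa [Nat.mul_div_cancel' hpN] using Nat.mul_dvd_mul_left p h)
  obtain ⟨u, v, huv⟩ := Nat.isCoprime_iff_coprime.mpr hcop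
  -- `u p + v (N/p) = 1`; take `γi = (p, -v; N/p, u)`
  refine ⟨⟨!![(p : ℤ), -v; (N / p : ℕ), u], by rw [Matrix.det_fin_two_of]; linear_combination huv⟩,
    ?_, ?_⟩
  · rw [Gamma0_mem]
    change (((N / p : ℕ) : ℤ) : ZMod (N / p)) = 0
    rw [Int.cast_natCast, ZMod.natCast_self]
  · change (p : ℤ) ∣ (p : ℤ)
    exact dvd_rfl

end NotSqDvd2

/-! ### Strong multiplicity one from the Main Lemma alone -/

section Corollary

variable {N : ℕ} [NeZero N] {k : ℤ}

/-- **Strong multiplicity one on `Γ₀(N)` from the Main Lemma alone**: with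
`disjoint_oldSubspace0_newSubspace0_holds` (`NewformsOldNewProofs`), the reduction
`IsNewform0.eq_of_heckeEigenvalue_eq_of_facts` (`NewformsLevelRaising`) leaves the Atkin–Lehner
Main Lemma `atkinLehnerMainLemma0 N k` (Atkin–Lehner 1970, Thm. 1) as the only input to
Atkin–Lehner 1970, Thm. 4 (same level). [cite: AtkinLehner1970, Thm. 4] -/
theorem IsNewform0.eq_of_heckeEigenvalue_eq_of_atkinLehnerMainLemma0 (hML : atkinLehnerMainLemma0 N k) :
    IsNewform0.eq_of_heckeEigenvalue_eq (N := N) (k := k) :=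
  IsNewform0.eq_of_heckeEigenvalue_eq_of_facts hML (disjoint_oldSubspace0_newSubspace0_holds N k)

end Corollary

end Literature.NumberTheory.EllipticCurves.ModularForms
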